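import Literature.AnabelianGeometry.AbsoluteAnabelian.AbsTopII.EllipticCuspidalizationContent
import Literature.AnabelianGeometry.AbsoluteAnabelian.AbsTopII.EllipticCuspidalizationTF

/-!
# [AbsTopII] Cor 3.3 (iii)(a): the chain CONTENT conjunct over the print-faithful successor record
# `EllipticCuspidalizationTF` (finding T1g11-F1; `RealizesChain` re-typed on the TF record, with the `toTF` bridge)

S. Mochizuki, *Topics in Absolute Anabelian Geometry II: Decomposition Groups and Endomorphisms*
[AbsTopII] (bib `MochizukiAbsTopII2013`; kurims manuscript `paper:url-585b8d0ad0d9`), §3, Corollary 3.3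
(iii)(a) p. 68 (with Example 3.2 (i)(ii) pp. 66–67 and [AbsTopI] Def 4.2 (iii) pp. 49–50):

> "(a) There exists a [not necessarily unique] `Π`-chain, which admits an entirely “group-theoretic”
> description, with associated type-chain `⋏, ⋎, ⋏, •, …, •, ⋏, ⋎` — cf. Example 3.2, (ii) — that admits a
> terminal isomorphism with the trivial `Π`-chain [of length 0], and whose final three groups consist of
> `Π_D ⇝ Π_V (↪ Π_D) ⇝ (Π_V ↪) Π` such that the natural surjection `Π_U ↠ Π_D` may be recovered from the
> chain of “•’s” terminating at the third to last group of the above-mentioned `Π`-chain".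

WHY THIS FILE (cell abc-iut; finding T1g11-F1, L4 dossier m165/m167; L6 impact census
`HOME/staging/L6/L6-t7/gen8/T1G11-F1-L6-IMPACT.md`, repair M1).  The FROZEN output record
`EllipticCuspidalization E` (abc-iut-L4-t6) types clause (ii) of Cor 3.3 as `IsMulTorsionFree ↥(Π_D ⊓ Δ_C)`
(unique roots) and is therefore UNINHABITED over every extension whose `Δ` is free pro-`Σ` of rank `≥ 2`
with two primes in `Σ` (`Summit.ABC.IUTFork.isEmpty_ellipticCuspidalization_of_isFreeProOn`, abc-iut-L4-t17);
its print-faithful successor is `EllipticCuspidalizationTF E` (abc-iut-L4-t4, `EllipticCuspidalizationTF.lean`: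
the same fields verbatim except (ii) := `∀ g, IsOfFinOrder g → g = 1`, with the one-way bridge
`EllipticCuspidalization.toTF`).  That successor file copies the record's API (`PiUV`, `typeChain`,
`toCuspidalization`, …) but NOT the chain-content predicate `EllipticCuspidalization.RealizesChain`
(abc-iut-L4-t6 lineage, `EllipticCuspidalizationContent.lean`), which every consumer of the chain clause
needs — in particular the [IUTchII] Prop 1.6 (ii) successor predicate `RefIsEllipticChain` (R2′) of layer L6,
to be re-pointed to the TF record.  THIS FILE supplies exactly that, append-only (nothing landed is edited):

* `EllipticCuspidalizationTF.RealizesChain` — the predicate of `EllipticCuspidalizationContent.lean` VERBATIM,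
  with `K : EllipticCuspidalizationTF E` (it reads only the fields `N`, `typeChain`, `cuspU`, `PiD`, `PiV`,
  `core`, `toCore`, `projU`, all of which the successor carries verbatim);
* `EllipticCuspidalization.realizesChain_toTF_iff` — for a FROZEN record `K`,
  `K.toTF.RealizesChain … ↔ K.RealizesChain …` definitionally (the bridge `toTF` copies the fields), so every
  landed chain-realization result transfers to the successor currency by `Iff.rfl` (consumers write
  `(K.realizesChain_toTF_iff S CD hP hΔ hne).2 h`).  Statement-only (one `def`, one `Iff.rfl` lemma).

HONEST FRAMING: a predicate on an OUTPUT structure over an abstract extension, relative to cuspidal data and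
slimness inputs; a re-typing of OUR output format; typed ≠ constructed; nothing here bears on [IUTchIII]
Cor 3.12 or asserts that abc is proved or refuted.  No instance, no notation; axioms standard.
-/

noncomputable section

open CategoryTheory Topology
open scoped Pointwise

universe u

namespace Literature.AnabelianGeometry.AbsoluteAnabelian.AbsTopII

open Literature.AlgebraicGeometry.Frobenioids (IsSlimGroup)
open FundamentalExtension

namespace EllipticCuspidalizationTF

variable {E : FundamentalExtension.{u}} (K : EllipticCuspidalizationTF E) (S : Set ℕ)
  (CD : CuspidalData E) (hP : IsSlimGroup E.arith) (hΔ : IsSlimGroup E.geom) (hne : E.geom ≠ ⊥)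

/-- **Cor 3.3 (iii)(a), the CONTENT of the chain clause, over the print-faithful successor record
`EllipticCuspidalizationTF`** (p. 68; Ex 3.2 (i)(ii) pp. 66–67): a genuine pro-`Σ` `Π`-chain `c`
([AbsTopI] Def 4.2 (iii), condition (3_Π) as `IsProSigmaChain S c`) of the output's recorded type-chain
`⋏, ⋎, ⋏, •^{N²−1}, ⋏, ⋎` with a terminal isomorphism to the trivial chain, "whose final three groups consist
of `Π_D ⇝ Π_V ⇝ Π`" — indices `s ≤ t < v`, `t` third-to-last, `v` second-to-last, `t − s = N² − 1`,
isomorphisms `Π_s ≅ Π_U` (the output's `cuspU`), `Π_t ≅ Π_D` (`PiD ⊆ Π_C`), `Π_v ≅ Π_V` over `G` up to inner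
automorphisms — "such that the natural surjection `Π_U ↠ Π_D` may be recovered from the chain of •’s
terminating at the third to last group": operation homomorphisms `φⱼ : Πⱼ ↠ Πⱼ₊₁` OF TYPE • for `s ≤ j < t`
whose composite (tracked by `ψ`) is, through `Π_s ≅ Π_U` and `Π_t ≅ Π_D`, the output's `Π_U ↠ Π_D`
(`projU`).  VERBATIM the predicate `EllipticCuspidalization.RealizesChain` of the frozen record, re-typed on
the successor (finding T1g11-F1).  Relative to cuspidal data `CD` on `Π` and the slimness inputs of `PiChain`.
[cite: MochizukiAbsTopII2013, Cor 3.3 (iii)(a) p.68] -/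
def RealizesChain : Prop :=
  ∃ c : E.PiChain CD hP hΔ hne,
    IsProSigmaChain S c ∧
    c.typeChain = K.typeChain.map ElementaryOp.toElemOpType ∧
    c.HasTerminalIso (trivialChain CD hP hΔ hne) ∧
    ∃ (s t v : Fin (c.len + 1)) (_ : s.val + (K.N ^ 2 - 1) = t.val) (_ : t.val + 1 = v.val)
      (_ : v.val + 1 = c.len)
      (eU : K.cuspU.arith ≃ₜ* (c.term s).grp) (eD : ↥K.PiD ≃ₜ* (c.term t).grp)
      (eV : ↥K.PiV ≃ₜ* (c.term v).grp) (gU gD : K.core.gal) (gV : E.gal)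
      (ψ : ∀ i : Fin (c.len + 1), K.cuspU.arith →* (c.term i).grp),
      (∀ x, K.toCore.gal ((c.term s).proj (eU x)) =
          MulAut.conj gU (K.projU.gal (K.cuspU.aug x))) ∧
      (∀ y : K.PiD, K.toCore.gal ((c.term t).proj (eD y)) = MulAut.conj gD (K.core.aug y)) ∧
      (∀ y : K.PiV, (c.term v).proj (eV y) = MulAut.conj gV (E.aug y)) ∧
      (∀ x, ψ s x = eU x) ∧
      (∀ j : Fin c.len, s.val ≤ j.val → j.val < t.val →
        ∃ φ : (c.term j.castSucc).grp →ₜ* (c.term j.succ).grp,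
          ChainGroup.IsDeCuspVia CD (c.term j.castSucc) (c.term j.succ) φ ∧
            ∀ x, ψ j.succ x = φ (ψ j.castSucc x)) ∧
      (∀ x, ((eD.symm (ψ t x) : ↥K.PiD) : K.core.arith) = K.projU.arith x)

end EllipticCuspidalizationTF

namespace EllipticCuspidalization

variable {E : FundamentalExtension.{u}} (K : EllipticCuspidalization E) (S : Set ℕ)
  (CD : CuspidalData E) (hP : IsSlimGroup E.arith) (hΔ : IsSlimGroup E.geom) (hne : E.geom ≠ ⊥)

/-- **Bridge (finding T1g11-F1).** For a FROZEN record `K`, the chain content over its print-faithful image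
`K.toTF` is the chain content over `K` — definitionally: `toTF` copies every field the predicate reads.
[cite: MochizukiAbsTopII2013, Cor 3.3 (iii)(a) p.68] -/
theorem realizesChain_toTF_iff :
    K.toTF.RealizesChain S CD hP hΔ hne ↔ K.RealizesChain S CD hP hΔ hne :=
  Iff.rfl

end EllipticCuspidalization

end Literature.AnabelianGeometry.AbsoluteAnabelian.AbsTopII
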